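import Literature.AlgebraicGeometry.Motives.AmpleDivisorVeryAmpleMultiple
import Literature.AlgebraicGeometry.Motives.FormsEmbedding
import HarnessLib

/-!
# Uniform hyperplane realisations of multiples of ample divisors (Hartshorne II Thm. 7.6, Ex. 5.13)

Topic `Literature/AlgebraicGeometry/Motives`; theorems only, companion of
`Motives/AmpleDivisorVeryAmpleMultiple` (`q • Θ ∼ H_ι` for SOME `q ≥ 1` and SOME closed immersion
`ι : Z ↪ ℙⁿ_k`) and `Motives/FormsEmbedding` (the re-embedding `formsMap : Y → ℙ(M)_k` of a closed
immersion `r : Y ↪ ℙ(ι)_k` by the forms `x_i^{2d}`, `x_{i'} x_i^{2d-1}`, `x_i^d V_l` of degree `2d`).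

What is proved (Hartshorne II Ex. 5.13: "`𝒪(d)` on `ℙⁿ` is very ample, the `d`-uple embedding";
II Thm. 7.6 and its proof: "if `𝓛^m` is very ample then so is every `𝓛^{md}`"; Görtz–Wedhorn I
Prop. 13.56 / (13.12)):

* `GeneratingSections.formsSec_val_none_none`, `GeneratingSections.ratioFn_ofHom_formsMap_none_none` —
  on the chart `r⁻¹D₊(xᵢ) = formsMap⁻¹D₊(y_{(i, none)})` the coordinate ratio
  `y_{(i₀, none)}/y_{(i, none)}` of the re-embedding pulls back to `r^*(x_{i₀}/xᵢ)^{2d}`;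
* `GeneratingSections.divisor_ofHom_formsMap_sameDivisor` — hence **the hyperplane divisor
  `div(y_{(i₀, none)})` of `formsMap` IS `2d • div(x_{i₀})`** (same Cartier divisor:
  `y_{(i₀,none)} = x_{i₀}^{2d}`), i.e. `formsMap^*𝒪(1) = r^*𝒪(2d)` at the level of hyperplane
  divisors;
* `CartierDivisor.LinEquiv.exists_hyperplaneDivisor_mul` — over a field: if `q • Θ ∼ H_ι` for a
  closed immersion `ι : Z ↪ ℙⁿ_k`, then for every `d ≥ 1` and every `ℓ` there is a closed immersion
  `ι' : Z ↪ ℙᴷ_k`, `K + 1 = (n + 1)(n + 2 + ℓ)` (the `ℓ` dummy forms `x_{a₀}^d` pad the target), with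
  `(q · 2d) • Θ ∼ H_{ι'}`;
* `CartierDivisor.IsAmple.exists_common_pos_smul_linEquiv_hyperplaneDivisor` — **for two ample
  divisors `Θ₁` on `Z₁`, `Θ₂` on `Z₂` (integral proper `k`-schemes) there are ONE `q ≥ 1` and ONE
  `K` and closed immersions `ιⱼ : Zⱼ ↪ ℙᴷ_k` with `q • Θⱼ ∼ H_{ιⱼ}`, `j = 1, 2`** (from
  `IsAmple.exists_smul_linEquiv_divisor` for each: multiply `q₁` by `2q₂` and `q₂` by `2q₁`, and pad
  both targets to `K + 1 = (n₁ + 1)(n₂ + 1)(n₁ + n₂ + 2)`), and `…_le` — the same with `K₀ ≤ K`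
  for any prescribed `K₀` (one more re-embedding with `K₀` dummy forms).

The last statement is the uniformisation step "(K3)" of the cell's flat-polarisation-Gram engine
(one `q` and one ambient `ℙᴷ` for a pair of fibres, so that the Chern-class comparison constants
agree). No Veronese map and no linear embedding `ℙⁿ ⊂ ℙᴷ` is needed: the forms re-embedding of
`Motives/FormsEmbedding` does both at once. Everything is proved; no definitions, no named facts.

## References

* R. Hartshorne, *Algebraic Geometry*, GTM 52, Springer (1977): II Ex. 5.13, II Thm. 7.1 (b),
  II Thm. 7.6 (p. 154) and its proof. [Hartshorne1977]
* U. Görtz, T. Wedhorn, *Algebraic Geometry I: Schemes*, 2nd ed., Springer Spektrum (2020):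
  (13.12), Prop. 13.56, Thm. 13.59 (2) (p. 503). [GortzWedhorn2020]

#harness_tags algebraic_geometry.ample_divisors, algebraic_geometry.projective_varieties
-/

universe u

open CategoryTheory AlgebraicGeometry Limits TopologicalSpace Opposite
open MvPolynomial (X)
open Literature.AlgebraicGeometry.Motives.Segre Literature.AlgebraicGeometry.Motives.RatFn

noncomputable section

namespace Literature.AlgebraicGeometry.Motives

namespace GeneratingSections

/-! ### The hyperplane divisor of the forms re-embedding at a coordinate `x_{i₀}^{2d}` -/

section FormsDivisor

variable {n : ℕ} {k : Type u} [Field k] {Y : Scheme.{u}} (f : Y ⟶ Spec (.of k))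
  (r : Y ⟶ (projectiveSpace n k).left) {d : ℕ} (hd : 0 < d) {L : Type}
  (V : L → MvPolynomial (Fin (n + 1)) k) (hV : ∀ l, (V l).IsHomogeneous d) {M : Type}
  (e : M ≃ Fin (n + 1) × (Option (Fin (n + 1)) ⊕ L))

/-- On the chart `r⁻¹D₊(xᵢ)` the section `σ_{(i₀, none)} = x_{i₀}^{2d}` of `r^*𝒪(2d)` has the value
`r^*(x_{i₀}/xᵢ)^{2d}`. [cite: Hartshorne1977, II Thm. 7.1 (b)] -/
theorem formsSec_val_none_none (i₀ i : Fin (n + 1)) :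
    (formsSec f r hd V hV (i₀, Sum.inl none)).val i = (ofHom r).ratio i i₀ ^ (d + d) := by
  simp only [formsSec, Sec.mul_val, formsτ, Sec.pow_val, ← pow_add]

variable [IsIntegral Y]

/-- **`formsMap^*(y_{(i₀, none)}/y_{(i, none)}) = r^*(x_{i₀}/xᵢ)^{2d}` as rational functions on `Y`**
(`Y` integral): the ratio of the two coordinates `x_{i₀}^{2d}`, `x_i^{2d}` of the forms re-embedding,
read at the generic point. [cite: Hartshorne1977, II Thm. 7.1 (b)] -/
theorem ratioFn_ofHom_formsMap_none_none {a b : M} {i i₀ : Fin (n + 1)} (ha : e a = (i, Sum.inl none))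
    (hb : e b = (i₀, Sum.inl none))
    (hξa : genericPoint Y ∈ (ofHom (formsMap f r hd V hV e)).U a)
    (hξi : genericPoint Y ∈ (ofHom r).U i) :
    (ofHom (formsMap f r hd V hV e)).ratioFn a b hξa = (ofHom r).ratioFn i i₀ hξi ^ (d + d) := by
  have key : ∀ m m' : Fin (n + 1) × (Option (Fin (n + 1)) ⊕ L), m = (i, Sum.inl none) →
      m' = (i₀, Sum.inl none) →
      ∀ {W : Y.Opens} (h : W ≤ (formsData f r hd V hV).U m) (h' : W ≤ (ofHom r).U i),
        rs h ((formsData f r hd V hV).ratio m m') = rs h' ((ofHom r).ratio i i₀ ^ (d + d)) := by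
    rintro _ _ rfl rfl W h h'
    rw [formsData_ratio_none, rs_rs, formsSec_val_none_none]
  have hW : (ofHom (formsMap f r hd V hV e)).U a ≤ (ofHom r).U i :=
    (formsMap_preimage_basicOpen_of_eq_none f r hd V hV e ha).le
  have h1 : (ofHom (formsMap f r hd V hV e)).ratio a b = rs hW ((ofHom r).ratio i i₀ ^ (d + d)) := by
    rw [ofHom_ratio, homRatio_formsMap]
    exact key _ _ ha hb _ hW
  change Y.presheaf.germ _ (genericPoint Y) hξa ((ofHom (formsMap f r hd V hV e)).ratio a b) =
    Y.presheaf.germ _ (genericPoint Y) hξi ((ofHom r).ratio i i₀) ^ (d + d)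
  rw [h1, ← map_pow]
  exact TopCat.Presheaf.germ_res_apply Y.presheaf (homOfLE hW) (genericPoint Y) hξa _

/-- **The hyperplane divisor of the forms re-embedding at the coordinate `y_{(i₀, none)} = x_{i₀}^{2d}`
is `2d • div(x_{i₀})`** — the two presentations define the same Cartier divisor: on the overlap of a
chart `formsMap⁻¹D₊(y_c)` with `r⁻¹D₊(x_j) = formsMap⁻¹D₊(y_{(j, none)})` the quotient of the local
equations `y_b/y_c` and `(x_{i₀}/x_j)^{2d} = y_b/y_{(j,none)}` is the unit `y_{(j,none)}/y_c`
(Hartshorne II Thm. 7.6, proof: `𝓛^m` very ample for `φ` ⇒ `𝓛^{md}` very ample for the composite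
with the `d`-uple embedding; here `formsMap^*𝒪(1) = r^*𝒪(2d)` on divisors).
[cite: Hartshorne1977, II Thm. 7.6 (p. 154), proof] -/
theorem divisor_ofHom_formsMap_sameDivisor {b : M} {i₀ : Fin (n + 1)} (hb : e b = (i₀, Sum.inl none))
    (hξb : genericPoint Y ∈ (ofHom (formsMap f r hd V hV e)).U b)
    (hξ₀ : genericPoint Y ∈ (ofHom r).U i₀) :
    ((ofHom (formsMap f r hd V hV e)).divisor b hξb).SameDivisor
      ((d + d) • (ofHom r).divisor i₀ hξ₀) := by
  rintro ⟨⟨c, hc⟩⟩ ⟨⟨j, hj⟩⟩ x hxc hxj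
  change x ∈ (ofHom (formsMap f r hd V hV e)).U c at hxc
  change x ∈ (ofHom r).U j at hxj
  change IsUnitAt x ((ofHom (formsMap f r hd V hV e)).ratioFn c b hc /
    (ofHom r).ratioFn j i₀ hj ^ (d + d))
  -- the coordinate `a' ↔ (j, none)`, whose chart is `r⁻¹D₊(x_j) ∋ x`
  have ha' : e (e.symm (j, Sum.inl none)) = (j, Sum.inl none) := e.apply_symm_apply _
  have hUa' : (ofHom (formsMap f r hd V hV e)).U (e.symm (j, Sum.inl none)) = (ofHom r).U j :=
    formsMap_preimage_basicOpen_of_eq_none f r hd V hV e ha'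
  have hxa' : x ∈ (ofHom (formsMap f r hd V hV e)).U (e.symm (j, Sum.inl none)) := by
    rw [hUa']
    exact hxj
  have hξa' : genericPoint Y ∈ (ofHom (formsMap f r hd V hV e)).U (e.symm (j, Sum.inl none)) :=
    genericPoint_mem_U _ hxa'
  rw [← (ofHom (formsMap f r hd V hV e)).ratioFn_mul_ratioFn c (e.symm (j, Sum.inl none)) b hc hξa',
    ratioFn_ofHom_formsMap_none_none f r hd V hV e ha' hb hξa' (genericPoint_mem_U _ hxj),
    mul_div_assoc, div_self (pow_ne_zero _ ((ofHom r).ratioFn_ne_zero j i₀ _ hξ₀)), mul_one]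
  exact (ofHom (formsMap f r hd V hV e)).isUnitAt_ratioFn (e.symm (j, Sum.inl none)) hxc hxa'

end FormsDivisor

end GeneratingSections

/-! ### Over a field: all the multiples `2d q`, in a projective space of prescribed size -/

namespace CartierDivisor

variable {k : Type u} [Field k] {Z : SchemeOver k} [IsIntegral Z.left] {Θ : CartierDivisor Z.left}

/-- **If `q • Θ` is a hyperplane section of a closed immersion `ι : Z ↪ ℙⁿ_k`, then so is
`(q · 2d) • Θ` for every `d ≥ 1`, along a closed immersion `ι' : Z ↪ ℙᴷ_k` with
`K + 1 = (n + 1)(n + 2 + ℓ)` for any `ℓ`** (the forms re-embedding of `Motives/FormsEmbedding` with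
`ℓ` dummy forms `x_{a₀}^d`; Hartshorne II Thm. 7.6, proof, with II Ex. 5.13 / 5.14: very ampleness
of `𝓛^{md}`, extra sections adjoined at will). [cite: Hartshorne1977, II Thm. 7.6 (p. 154), proof] -/
theorem LinEquiv.exists_hyperplaneDivisor_mul {q n : ℕ} {ι : Z ⟶ projectiveSpace n k}
    (hι : IsClosedImmersion ι.left) {a₀ : Fin (n + 1)}
    {ha₀ : genericPoint Z.left ∈ (GeneratingSections.ofHom ι.left).U a₀}
    (h : (q • Θ).LinEquiv ((GeneratingSections.ofHom ι.left).divisor a₀ ha₀)) {d : ℕ} (hd : 0 < d)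
    (ℓ : ℕ) {K : ℕ} (hK : K + 1 = (n + 1) * (n + 2 + ℓ)) :
    ∃ (ι' : Z ⟶ projectiveSpace K k) (_ : IsClosedImmersion ι'.left) (a : Fin (K + 1))
      (ha : genericPoint Z.left ∈ (GeneratingSections.ofHom ι'.left).U a),
      ((q * (d + d)) • Θ).LinEquiv ((GeneratingSections.ofHom ι'.left).divisor a ha) := by
  -- the labelling of the `(n + 1)(n + 2 + ℓ)` new coordinates by `Fin (K + 1)`
  have hcard : Fintype.card (Fin (K + 1)) =
      Fintype.card (Fin (n + 1) × (Option (Fin (n + 1)) ⊕ Fin ℓ)) := by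
    simp only [Fintype.card_fin, Fintype.card_prod, Fintype.card_sum, Fintype.card_option, hK]
  set e : Fin (K + 1) ≃ Fin (n + 1) × (Option (Fin (n + 1)) ⊕ Fin ℓ) := Fintype.equivOfCardEq hcard
  -- the dummy forms `x_{a₀}^d`
  set V : Fin ℓ → MvPolynomial (Fin (n + 1)) k := fun _ ↦ X a₀ ^ d
  have hV : ∀ l, (V l).IsHomogeneous d := fun l ↦ by
    simpa using (MvPolynomial.isHomogeneous_X k a₀).pow d
  -- the re-embedding (a closed immersion over `k`) and its home coordinate `a ↔ (a₀, none)`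
  set φ : Z.left ⟶ (projectiveSpace K k).left :=
    GeneratingSections.formsMap Z.hom ι.left hd V hV e
  have hφι : IsClosedImmersion φ :=
    @GeneratingSections.isClosedImmersion_formsMap _ _ _ _ Z.hom ι.left _ hd _ V hV _ e _ (Over.w ι) hι
  set ι' : Z ⟶ projectiveSpace K k :=
    Over.homMk φ (GeneratingSections.formsMap_toSpec Z.hom ι.left hd V hV e)
  set a : Fin (K + 1) := e.symm (a₀, Sum.inl none)
  have ha' : e a = (a₀, Sum.inl none) := e.apply_symm_apply _
  have hUa : (GeneratingSections.ofHom φ).U a = (GeneratingSections.ofHom ι.left).U a₀ :=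
    GeneratingSections.formsMap_preimage_basicOpen_of_eq_none Z.hom ι.left hd V hV e ha'
  have ha : genericPoint Z.left ∈ (GeneratingSections.ofHom φ).U a := by
    rw [hUa]
    exact ha₀
  refine ⟨ι', hφι, a, ha, ?_⟩
  -- `(q · 2d) • Θ = 2d • (q • Θ) ∼ 2d • H_ι = H_{ι'}`
  rw [← CartierDivisor.smul_smul]
  exact (h.smul (d + d)).trans
    (GeneratingSections.divisor_ofHom_formsMap_sameDivisor Z.hom ι.left hd V hV e ha' ha ha₀).symm.linEquiv

/-- **One multiple and one projective space for a pair of ample divisors.** For integral proper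
`k`-schemes `Z₁`, `Z₂` with ample Cartier divisors `Θ₁`, `Θ₂` there are `q ≥ 1`, `K` and closed
`k`-immersions `ι₁ : Z₁ ↪ ℙᴷ_k`, `ι₂ : Z₂ ↪ ℙᴷ_k` with coordinates `x_{a₁}`, `x_{a₂}` such that
`q • Θ₁ ∼ H_{ι₁} = div(ι₁^*x_{a₁})` and `q • Θ₂ ∼ H_{ι₂} = div(ι₂^*x_{a₂})` (Hartshorne II Thm. 7.6
for each, `qⱼ • Θⱼ ∼ H`, then the multiples `q₁ · 2q₂ = q₂ · 2q₁` realised by the forms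
re-embeddings padded to the common size `K + 1 = (n₁ + 1)(n₂ + 1)(n₁ + n₂ + 2)`).
[cite: Hartshorne1977, II Thm. 7.6 (p. 154)] -/
theorem IsAmple.exists_common_pos_smul_linEquiv_hyperplaneDivisor {Z₁ Z₂ : SchemeOver k}
    [IsIntegral Z₁.left] [IsProper Z₁.hom] [IsIntegral Z₂.left] [IsProper Z₂.hom]
    {Θ₁ : CartierDivisor Z₁.left} {Θ₂ : CartierDivisor Z₂.left} (h₁ : Θ₁.IsAmple)
    (h₂ : Θ₂.IsAmple) :
    ∃ q : ℕ, 0 < q ∧ ∃ K : ℕ,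
      (∃ (ι : Z₁ ⟶ projectiveSpace K k) (_ : IsClosedImmersion ι.left) (a : Fin (K + 1))
          (ha : genericPoint Z₁.left ∈ (GeneratingSections.ofHom ι.left).U a),
          (q • Θ₁).LinEquiv ((GeneratingSections.ofHom ι.left).divisor a ha)) ∧
      (∃ (ι : Z₂ ⟶ projectiveSpace K k) (_ : IsClosedImmersion ι.left) (a : Fin (K + 1))
          (ha : genericPoint Z₂.left ∈ (GeneratingSections.ofHom ι.left).U a),
          (q • Θ₂).LinEquiv ((GeneratingSections.ofHom ι.left).divisor a ha)) := by
  obtain ⟨q₁, n₁, ι₁, hι₁, a₁, ha₁, hq₁, hl₁⟩ := h₁.exists_smul_linEquiv_divisor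
  obtain ⟨q₂, n₂, ι₂, hι₂, a₂, ha₂, hq₂, hl₂⟩ := h₂.exists_smul_linEquiv_divisor
  -- the common target size `K + 1 = (n₁ + 1)(n₂ + 1)(n₁ + n₂ + 2)`
  obtain ⟨K, hK⟩ : ∃ K : ℕ, K + 1 = (n₁ + 1) * (n₂ + 1) * (n₁ + n₂ + 2) :=
    ⟨(n₁ + 1) * (n₂ + 1) * (n₁ + n₂ + 2) - 1, Nat.sub_add_cancel (Nat.one_le_iff_ne_zero.2
      (Nat.mul_ne_zero (Nat.mul_ne_zero (Nat.succ_ne_zero _) (Nat.succ_ne_zero _))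
        (Nat.succ_ne_zero _)))⟩
  have hK₁ : K + 1 = (n₁ + 1) * (n₁ + 2 + n₂ * (n₁ + n₂ + 3)) := by rw [hK]; ring
  have hK₂ : K + 1 = (n₂ + 1) * (n₂ + 2 + n₁ * (n₁ + n₂ + 3)) := by rw [hK]; ring
  obtain ⟨ι₁', hι₁', b₁, hb₁, hl₁'⟩ := hl₁.exists_hyperplaneDivisor_mul hι₁ hq₂ _ hK₁
  obtain ⟨ι₂', hι₂', b₂, hb₂, hl₂'⟩ := hl₂.exists_hyperplaneDivisor_mul hι₂ hq₁ _ hK₂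
  refine ⟨q₁ * (q₂ + q₂), Nat.mul_pos hq₁ (Nat.add_pos_left hq₂ _), K,
    ⟨ι₁', hι₁', b₁, hb₁, hl₁'⟩, ⟨ι₂', hι₂', b₂, hb₂, ?_⟩⟩
  rw [show q₁ * (q₂ + q₂) = q₂ * (q₁ + q₁) by ring]
  exact hl₂'

/-- **The same with the common projective space as large as prescribed**: for every `K₀` the common
`ℙᴷ_k` of `IsAmple.exists_common_pos_smul_linEquiv_hyperplaneDivisor` can be taken with `K₀ ≤ K` (one
more forms re-embedding of both, `d = 1`, `ℓ = K₀` dummy forms: `K' + 1 = (K + 1)(K + 2 + K₀)`,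
`q' = 2q`) — the form wanted when the ambient dimension must dominate a given one (e.g. `g ≤ K`).
[cite: Hartshorne1977, II Thm. 7.6 (p. 154)] -/
theorem IsAmple.exists_common_pos_smul_linEquiv_hyperplaneDivisor_le {Z₁ Z₂ : SchemeOver k}
    [IsIntegral Z₁.left] [IsProper Z₁.hom] [IsIntegral Z₂.left] [IsProper Z₂.hom]
    {Θ₁ : CartierDivisor Z₁.left} {Θ₂ : CartierDivisor Z₂.left} (h₁ : Θ₁.IsAmple)
    (h₂ : Θ₂.IsAmple) (K₀ : ℕ) :
    ∃ q : ℕ, 0 < q ∧ ∃ K : ℕ, K₀ ≤ K ∧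
      (∃ (ι : Z₁ ⟶ projectiveSpace K k) (_ : IsClosedImmersion ι.left) (a : Fin (K + 1))
          (ha : genericPoint Z₁.left ∈ (GeneratingSections.ofHom ι.left).U a),
          (q • Θ₁).LinEquiv ((GeneratingSections.ofHom ι.left).divisor a ha)) ∧
      (∃ (ι : Z₂ ⟶ projectiveSpace K k) (_ : IsClosedImmersion ι.left) (a : Fin (K + 1))
          (ha : genericPoint Z₂.left ∈ (GeneratingSections.ofHom ι.left).U a),
          (q • Θ₂).LinEquiv ((GeneratingSections.ofHom ι.left).divisor a ha)) := by
  obtain ⟨q, hq, K, ⟨ι₁, hι₁, a₁, ha₁, hl₁⟩, ⟨ι₂, hι₂, a₂, ha₂, hl₂⟩⟩ :=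
    h₁.exists_common_pos_smul_linEquiv_hyperplaneDivisor h₂
  -- one more re-embedding of both, with `K₀` dummy forms: `K' + 1 = (K + 1)(K + 2 + K₀)`
  obtain ⟨K', hK'⟩ : ∃ K' : ℕ, K' + 1 = (K + 1) * (K + 2 + K₀) :=
    ⟨(K + 1) * (K + 2 + K₀) - 1, Nat.sub_add_cancel (Nat.one_le_iff_ne_zero.2
      (Nat.mul_ne_zero (Nat.succ_ne_zero _) (by omega)))⟩
  obtain ⟨ι₁', hι₁', b₁, hb₁, hl₁'⟩ := hl₁.exists_hyperplaneDivisor_mul hι₁ Nat.one_pos K₀ hK'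
  obtain ⟨ι₂', hι₂', b₂, hb₂, hl₂'⟩ := hl₂.exists_hyperplaneDivisor_mul hι₂ Nat.one_pos K₀ hK'
  refine ⟨q * (1 + 1), Nat.mul_pos hq (Nat.add_pos_left Nat.one_pos _), K', ?_,
    ⟨ι₁', hι₁', b₁, hb₁, hl₁'⟩, ⟨ι₂', hι₂', b₂, hb₂, hl₂'⟩⟩
  have hle : K + 2 + K₀ ≤ K' + 1 := by
    rw [hK']
    exact Nat.le_mul_of_pos_left _ (Nat.succ_pos K)
  omega

end CartierDivisor

end Literature.AlgebraicGeometry.Motives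

end
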